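import Summits.ResolutionOfSingularities.ResolutionOfSingularities.Theorems.FrobeniusLadderFInjectiveMacaulayficationE8LineStrongPlusStep
import Mathlib.RingTheory.MvPolynomial.WeightedHomogeneous
import HarnessLib

/-!
# `E₈⁰ × 𝔸¹` DEFORMED ALONG THE LINE: data for the first NON-CONICAL calibration of the relative filtered engine
# (crux `FrobeniusLadder.FInjectiveMacaulayfication` stmt-ResolutionOfSingularities-15315, chain w45a; lead seat res-L1-w45a-lead-1 gen 3)

[OURS · L1 W4.5a] AI-written; AI review is weaker than expert review. NOT a statement of any manuscript; no named fact.

`f = X₃² + X₁³ + X₂⁵ + X₀·X₁²X₂² ∈ k[X₀,…,X₃]`: along the line `V(X₁,X₂,X₃)` this is the `E₈⁰` cone deformed by a term of HIGHER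
`(0,10,6,15)`-weight (`32 > 30`) whose coefficient varies along the line — not quasi-homogeneous for any positive weights on
`X₁,X₂,X₃` extended by `0`, and (at `p = 2,3,5`) outside the Cartier–Newton class. This file certifies the inputs of the relative
filtered engine `FilteredConeFiModelRel` (lead) for it: the initial form `in_w f = X₃² + X₁³ + X₂⁵` and the vanishing of the lower
components; `(f)` prime (monic quadratic in `X₃` over the UFD `k[X₀,X₁,X₂]` with `-(X₁³+X₂⁵+X₀X₁²X₂²)` a non-square by the odd-degree
test); no variable in `(f)`; `f ∈ (X₁,X₂,X₃)`; and REGULARITY OFF THE LINE uniformly in `p` (if `x̄₁, x̄₂ ∉ P` the partial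
`∂f/∂X₀ = X₁²X₂²` works; otherwise one of `3X₁² + 2X₀X₁X₂²`, `5X₂⁴ + 2X₀X₁²X₂`, `2X₃` does, as at most one of `2,3,5` vanishes in `k`).
No definitions, no named facts. [folklore]
-/

set_option linter.dupNamespace false

noncomputable section

open Polynomial Literature.AlgebraicGeometry.Resolution AlgebraicGeometry

namespace Summit.ResolutionOfSingularities.ResolutionOfSingularities.Theorems.FInjectiveMacaulayfication.E8LineDeformedData

open Summit.ResolutionOfSingularities.ResolutionOfSingularities.Theorems.FInjectiveMacaulayfication

/-! ## The initial form -/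

/-- The deformation term `X₀X₁²X₂²` is `(0,10,6,15)`-homogeneous of weight `32`. [folklore] -/
theorem tail_isWeightedHomogeneous (k : Type) [Field k] :
    MvPolynomial.IsWeightedHomogeneous (![0, 10, 6, 15] : Fin 4 → ℕ)
      (MvPolynomial.X 0 * MvPolynomial.X 1 ^ 2 * MvPolynomial.X 2 ^ 2 : MvPolynomial (Fin 4) k) 32 := by
  have h0 := MvPolynomial.isWeightedHomogeneous_X k (![0, 10, 6, 15] : Fin 4 → ℕ) 0
  have h1 := (MvPolynomial.isWeightedHomogeneous_X k (![0, 10, 6, 15] : Fin 4 → ℕ) 1).pow 2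
  have h2 := (MvPolynomial.isWeightedHomogeneous_X k (![0, 10, 6, 15] : Fin 4 → ℕ) 2).pow 2
  have h := (h0.mul h1).mul h2
  simpa using h

/-- `in_w f = X₃² + X₁³ + X₂⁵` and all components of weight `< 30` vanish. [folklore] -/
theorem initialForm (k : Type) [Field k] (f : MvPolynomial (Fin 4) k)
    (hf : f = MvPolynomial.X 3 ^ 2 + MvPolynomial.X 1 ^ 3 + MvPolynomial.X 2 ^ 5 +
      MvPolynomial.X 0 * MvPolynomial.X 1 ^ 2 * MvPolynomial.X 2 ^ 2) :
    MvPolynomial.weightedHomogeneousComponent (![0, 10, 6, 15] : Fin 4 → ℕ) 30 f =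
        MvPolynomial.X 3 ^ 2 + MvPolynomial.X 1 ^ 3 + MvPolynomial.X 2 ^ 5 ∧
      ∀ m < 30, MvPolynomial.weightedHomogeneousComponent (![0, 10, 6, 15] : Fin 4 → ℕ) m f = 0 := by
  classical
  have h30 : (MvPolynomial.X 3 ^ 2 + MvPolynomial.X 1 ^ 3 + MvPolynomial.X 2 ^ 5 : MvPolynomial (Fin 4) k) ∈
      MvPolynomial.weightedHomogeneousSubmodule k (![0, 10, 6, 15] : Fin 4 → ℕ) 30 := by
    rw [MvPolynomial.mem_weightedHomogeneousSubmodule]; exact E8LineGradedFiModel.f_isWeightedHomogeneous k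
  have h32 : (MvPolynomial.X 0 * MvPolynomial.X 1 ^ 2 * MvPolynomial.X 2 ^ 2 : MvPolynomial (Fin 4) k) ∈
      MvPolynomial.weightedHomogeneousSubmodule k (![0, 10, 6, 15] : Fin 4 → ℕ) 32 := by
    rw [MvPolynomial.mem_weightedHomogeneousSubmodule]; exact tail_isWeightedHomogeneous k
  refine ⟨?_, fun m hm => ?_⟩
  · rw [hf, map_add, MvPolynomial.weightedHomogeneousComponent_of_mem h30,
      MvPolynomial.weightedHomogeneousComponent_of_mem h32, if_pos rfl, if_neg (by norm_num), add_zero]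
  · rw [hf, map_add, MvPolynomial.weightedHomogeneousComponent_of_mem h30,
      MvPolynomial.weightedHomogeneousComponent_of_mem h32, if_neg (by omega), if_neg (by omega), add_zero]

/-- `in_w f ≠ 0` (it takes the value `1` at `(0,1,0,0)`). [folklore] -/
theorem initialForm_ne_zero (k : Type) [Field k] :
    (MvPolynomial.X 3 ^ 2 + MvPolynomial.X 1 ^ 3 + MvPolynomial.X 2 ^ 5 : MvPolynomial (Fin 4) k) ≠ 0 := by
  intro h
  have h1 := congrArg (MvPolynomial.eval (![0, 1, 0, 0] : Fin 4 → k)) h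
  simp at h1

/-! ## Primality of `(f)` and no variable in `(f)` -/

/-- Odd-degree test for non-squares, three variables (cf. `E8Forms.mul_self_ne_neg_of_aeval`). [folklore] -/
theorem mul_self_ne_neg_of_aeval₃ {k : Type} [Field k] {c : MvPolynomial (Fin 3) k}
    (v : Fin 3 → k[X]) (n : ℕ) (hv : MvPolynomial.aeval v c = -(X ^ (2 * n + 1) : k[X]))
    (a : MvPolynomial (Fin 3) k) : a * a ≠ -c := by
  intro h
  have h2 : MvPolynomial.aeval v a * MvPolynomial.aeval v a = (X ^ (2 * n + 1) : k[X]) := by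
    rw [← map_mul, h, map_neg, hv, neg_neg]
  have hX : (X ^ (2 * n + 1) : k[X]) ≠ 0 := pow_ne_zero _ X_ne_zero
  have ha : MvPolynomial.aeval v a ≠ 0 := by
    intro h0
    rw [h0, zero_mul] at h2
    exact hX h2.symm
  have h3 := congrArg Polynomial.natDegree h2
  rw [natDegree_mul ha ha, natDegree_X_pow] at h3
  omega

/-- **`(f)` is prime** in `k[X₀,…,X₃]`: along `k[X₀,…,X₃] ≃ k[Y₀,Y₁,Y₂][T]` (`X₃ ↦ T`, `X₁ ↦ Y₀`, `X₂ ↦ Y₁`, `X₀ ↦ Y₂`) it is the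
monic quadratic `T² + (Y₀³ + Y₁⁵ + Y₂Y₀²Y₁²)`, and `-(…)` is not a square (`Y ↦ (-T, 0, 0)` gives `-T³`). [folklore] -/
theorem isPrime_span_f (k : Type) [Field k] (f : MvPolynomial (Fin 4) k)
    (hf : f = MvPolynomial.X 3 ^ 2 + MvPolynomial.X 1 ^ 3 + MvPolynomial.X 2 ^ 5 +
      MvPolynomial.X 0 * MvPolynomial.X 1 ^ 2 * MvPolynomial.X 2 ^ 2) :
    (Ideal.span {f}).IsPrime ∧ ∀ i : Fin 4, MvPolynomial.X i ∉ Ideal.span {f} := by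
  obtain ⟨e, he0, he1, he2, he3⟩ : ∃ e : MvPolynomial (Fin 4) k ≃+* (MvPolynomial (Fin 3) k)[X],
      e (MvPolynomial.X 0) = C (MvPolynomial.X 2) ∧ e (MvPolynomial.X 1) = C (MvPolynomial.X 0) ∧
        e (MvPolynomial.X 2) = C (MvPolynomial.X 1) ∧ e (MvPolynomial.X 3) = Polynomial.X := by
    refine ⟨((MvPolynomial.renameEquiv k (Equiv.swap (0 : Fin 4) 3)).trans
      (MvPolynomial.finSuccEquiv k 3)).toRingEquiv, ?_, ?_, ?_, ?_⟩
    · show MvPolynomial.finSuccEquiv k 3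
          (MvPolynomial.rename (Equiv.swap (0 : Fin 4) 3) (MvPolynomial.X 0)) = _
      rw [MvPolynomial.rename_X, Equiv.swap_apply_left]
      exact MvPolynomial.finSuccEquiv_X_succ (j := 2)
    · show MvPolynomial.finSuccEquiv k 3
          (MvPolynomial.rename (Equiv.swap (0 : Fin 4) 3) (MvPolynomial.X 1)) = _
      rw [MvPolynomial.rename_X, Equiv.swap_apply_of_ne_of_ne (by decide) (by decide)]
      exact MvPolynomial.finSuccEquiv_X_succ (j := 0)
    · show MvPolynomial.finSuccEquiv k 3
          (MvPolynomial.rename (Equiv.swap (0 : Fin 4) 3) (MvPolynomial.X 2)) = _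
      rw [MvPolynomial.rename_X, Equiv.swap_apply_of_ne_of_ne (by decide) (by decide)]
      exact MvPolynomial.finSuccEquiv_X_succ (j := 1)
    · show MvPolynomial.finSuccEquiv k 3
          (MvPolynomial.rename (Equiv.swap (0 : Fin 4) 3) (MvPolynomial.X 3)) = _
      rw [MvPolynomial.rename_X, Equiv.swap_apply_right]
      exact MvPolynomial.finSuccEquiv_X_zero
  have hef : e f = X ^ 2 + C (MvPolynomial.X 0 ^ 3 + MvPolynomial.X 1 ^ 5 +
      MvPolynomial.X 2 * MvPolynomial.X 0 ^ 2 * MvPolynomial.X 1 ^ 2) := by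
    subst hf
    simp only [map_add, map_mul, map_pow, he0, he1, he2, he3]
    ring
  have hcf : ∀ a : MvPolynomial (Fin 3) k,
      a * a ≠ -(MvPolynomial.X 0 ^ 3 + MvPolynomial.X 1 ^ 5 + MvPolynomial.X 2 * MvPolynomial.X 0 ^ 2 * MvPolynomial.X 1 ^ 2) :=
    mul_self_ne_neg_of_aeval₃ ![-Polynomial.X, 0, 0] 1 (by
      simp only [map_add, map_mul, map_pow, MvPolynomial.aeval_X, Matrix.cons_val_zero, Matrix.cons_val_one,
        Matrix.cons_val]
      ring)
  obtain ⟨hpf, -⟩ := E8Forms.prime_and_not_dvd_of_ringEquiv e f _ hef hcf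
  have hprime : (Ideal.span {f}).IsPrime := (Ideal.span_singleton_prime hpf.ne_zero).mpr hpf
  refine ⟨hprime, fun i => PrimeTransfer.X_not_mem_span_of_isPrime hprime ?_⟩
  fin_cases i
  · refine ThreefoldNotDvd.not_mem_span_X_of_eval_eq_one 0 ![0, 1, 0, 0] rfl ?_
    subst hf; simp
  · refine ThreefoldNotDvd.not_mem_span_X_of_eval_eq_one 1 ![0, 0, 0, 1] rfl ?_
    subst hf; simp
  · refine ThreefoldNotDvd.not_mem_span_X_of_eval_eq_one 2 ![0, 0, 0, 1] rfl ?_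
    subst hf; simp
  · refine ThreefoldNotDvd.not_mem_span_X_of_eval_eq_one 3 ![0, 1, 0, 0] rfl ?_
    subst hf; simp

/-- `x̄_v ≠ 0` in `k[X]/(f)` for every variable. [folklore] -/
theorem X_ne_zero (k : Type) [Field k] (f : MvPolynomial (Fin 4) k)
    (hf : f = MvPolynomial.X 3 ^ 2 + MvPolynomial.X 1 ^ 3 + MvPolynomial.X 2 ^ 5 +
      MvPolynomial.X 0 * MvPolynomial.X 1 ^ 2 * MvPolynomial.X 2 ^ 2)
    (v : Fin 4) : Ideal.Quotient.mk (Ideal.span {f}) (MvPolynomial.X v) ≠ 0 := fun h =>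
  (isPrime_span_f k f hf).2 v (Ideal.Quotient.eq_zero_iff_mem.mp h)

/-- `f ∈ (X₁, X₂, X₃)`: every term involves a variable of the line's ideal. [folklore] -/
theorem f_mem_span_line (k : Type) [Field k] (f : MvPolynomial (Fin 4) k)
    (hf : f = MvPolynomial.X 3 ^ 2 + MvPolynomial.X 1 ^ 3 + MvPolynomial.X 2 ^ 5 +
      MvPolynomial.X 0 * MvPolynomial.X 1 ^ 2 * MvPolynomial.X 2 ^ 2) :
    f ∈ Ideal.span (MvPolynomial.X '' ((({1, 2, 3} : Finset (Fin 4)) : Set (Fin 4))) : Set (MvPolynomial (Fin 4) k)) := by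
  have hX : ∀ i ∈ ({1, 2, 3} : Finset (Fin 4)), (MvPolynomial.X i : MvPolynomial (Fin 4) k) ∈
      Ideal.span (MvPolynomial.X '' ((({1, 2, 3} : Finset (Fin 4)) : Set (Fin 4))) : Set (MvPolynomial (Fin 4) k)) :=
    fun i hi => Ideal.subset_span ⟨i, Finset.mem_coe.mpr hi, rfl⟩
  rw [hf]
  refine Ideal.add_mem _ (Ideal.add_mem _ (Ideal.add_mem _ ?_ ?_) ?_) ?_
  · exact Ideal.pow_mem_of_mem _ (hX 3 (by decide)) 2 two_pos
  · exact Ideal.pow_mem_of_mem _ (hX 1 (by decide)) 3 three_pos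
  · exact Ideal.pow_mem_of_mem _ (hX 2 (by decide)) 5 (by norm_num)
  · exact Ideal.mul_mem_right _ _ (Ideal.mul_mem_left _ _ (Ideal.pow_mem_of_mem _ (hX 1 (by decide)) 2 two_pos))

/-- The line `(x̄₁, x̄₂, x̄₃)` is prime in `k[X]/(f)`. [folklore] -/
theorem isPrime_span_line (k : Type) [Field k] (f : MvPolynomial (Fin 4) k)
    (hf : f = MvPolynomial.X 3 ^ 2 + MvPolynomial.X 1 ^ 3 + MvPolynomial.X 2 ^ 5 +
      MvPolynomial.X 0 * MvPolynomial.X 1 ^ 2 * MvPolynomial.X 2 ^ 2) :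
    (Ideal.span ((fun j : Fin 4 => Ideal.Quotient.mk (Ideal.span {f}) (MvPolynomial.X j)) ''
      ((({1, 2, 3} : Finset (Fin 4)) : Set (Fin 4))))).IsPrime := by
  have heq : Ideal.span ((fun j : Fin 4 => Ideal.Quotient.mk (Ideal.span {f}) (MvPolynomial.X j)) ''
      ((({1, 2, 3} : Finset (Fin 4)) : Set (Fin 4)))) =
      (Ideal.span (MvPolynomial.X '' ((({1, 2, 3} : Finset (Fin 4)) : Set (Fin 4))) : Set (MvPolynomial (Fin 4) k))).map
        (Ideal.Quotient.mk (Ideal.span {f})) := by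
    rw [Ideal.map_span, Set.image_image]
  rw [heq]
  haveI := E8LineStrongPlusStep.isPrime_span_X_image (k := k) ((({1, 2, 3} : Finset (Fin 4)) : Set (Fin 4)))
  refine Ideal.map_isPrime_of_surjective Ideal.Quotient.mk_surjective ?_
  rw [Ideal.mk_ker, Ideal.span_le, Set.singleton_subset_iff]
  exact f_mem_span_line k f hf

/-! ## Regularity off the line, uniformly in the characteristic -/

/-- The four partial derivatives of `f`. [folklore] -/
theorem pderivs (A : Type) [CommRing A] :
    MvPolynomial.pderiv 0 (MvPolynomial.X 3 ^ 2 + MvPolynomial.X 1 ^ 3 + MvPolynomial.X 2 ^ 5 +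
        MvPolynomial.X 0 * MvPolynomial.X 1 ^ 2 * MvPolynomial.X 2 ^ 2 : MvPolynomial (Fin 4) A) =
        MvPolynomial.X 1 ^ 2 * MvPolynomial.X 2 ^ 2 ∧
      MvPolynomial.pderiv 1 (MvPolynomial.X 3 ^ 2 + MvPolynomial.X 1 ^ 3 + MvPolynomial.X 2 ^ 5 +
        MvPolynomial.X 0 * MvPolynomial.X 1 ^ 2 * MvPolynomial.X 2 ^ 2 : MvPolynomial (Fin 4) A) =
        MvPolynomial.C 3 * MvPolynomial.X 1 ^ 2 + MvPolynomial.C 2 * (MvPolynomial.X 0 * MvPolynomial.X 1 * MvPolynomial.X 2 ^ 2) ∧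
      MvPolynomial.pderiv 2 (MvPolynomial.X 3 ^ 2 + MvPolynomial.X 1 ^ 3 + MvPolynomial.X 2 ^ 5 +
        MvPolynomial.X 0 * MvPolynomial.X 1 ^ 2 * MvPolynomial.X 2 ^ 2 : MvPolynomial (Fin 4) A) =
        MvPolynomial.C 5 * MvPolynomial.X 2 ^ 4 + MvPolynomial.C 2 * (MvPolynomial.X 0 * MvPolynomial.X 1 ^ 2 * MvPolynomial.X 2) ∧
      MvPolynomial.pderiv 3 (MvPolynomial.X 3 ^ 2 + MvPolynomial.X 1 ^ 3 + MvPolynomial.X 2 ^ 5 +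
        MvPolynomial.X 0 * MvPolynomial.X 1 ^ 2 * MvPolynomial.X 2 ^ 2 : MvPolynomial (Fin 4) A) =
        MvPolynomial.C 2 * MvPolynomial.X 3 := by
  refine ⟨?_, ?_, ?_, ?_⟩ <;>
  · simp only [map_add, Derivation.leibniz, MvPolynomial.pderiv_pow, MvPolynomial.pderiv_X_self,
      MvPolynomial.pderiv_X_of_ne (show (1 : Fin 4) ≠ 0 by decide), MvPolynomial.pderiv_X_of_ne (show (2 : Fin 4) ≠ 0 by decide),
      MvPolynomial.pderiv_X_of_ne (show (3 : Fin 4) ≠ 0 by decide), MvPolynomial.pderiv_X_of_ne (show (0 : Fin 4) ≠ 1 by decide),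
      MvPolynomial.pderiv_X_of_ne (show (2 : Fin 4) ≠ 1 by decide), MvPolynomial.pderiv_X_of_ne (show (3 : Fin 4) ≠ 1 by decide),
      MvPolynomial.pderiv_X_of_ne (show (0 : Fin 4) ≠ 2 by decide), MvPolynomial.pderiv_X_of_ne (show (1 : Fin 4) ≠ 2 by decide),
      MvPolynomial.pderiv_X_of_ne (show (3 : Fin 4) ≠ 2 by decide), MvPolynomial.pderiv_X_of_ne (show (0 : Fin 4) ≠ 3 by decide),
      MvPolynomial.pderiv_X_of_ne (show (1 : Fin 4) ≠ 3 by decide), MvPolynomial.pderiv_X_of_ne (show (2 : Fin 4) ≠ 3 by decide),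
      smul_eq_mul, mul_zero, add_zero, zero_add, mul_one, map_ofNat]
    ring

/-- **`V(f)` is regular off the line `V(X₁,X₂,X₃)`**, in every characteristic (Jacobian criterion with the partial chosen by
the case analysis in the module docstring). [folklore] -/
theorem regular_off_line (k : Type) [Field k] (f : MvPolynomial (Fin 4) k)
    (hf : f = MvPolynomial.X 3 ^ 2 + MvPolynomial.X 1 ^ 3 + MvPolynomial.X 2 ^ 5 +
      MvPolynomial.X 0 * MvPolynomial.X 1 ^ 2 * MvPolynomial.X 2 ^ 2)
    (P : Ideal (MvPolynomial (Fin 4) k ⧸ Ideal.span {f})) [P.IsPrime]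
    (hP : ¬ Ideal.span ((fun j : Fin 4 => Ideal.Quotient.mk (Ideal.span {f}) (MvPolynomial.X j)) ''
      ((({1, 2, 3} : Finset (Fin 4)) : Set (Fin 4)))) ≤ P) :
    IsRegularLocalRing (Localization.AtPrime P) := by
  haveI hprime : (P.comap (Ideal.Quotient.mk (Ideal.span {f}))).IsPrime := Ideal.comap_isPrime _ _
  have hfP : f ∈ P.comap (Ideal.Quotient.mk (Ideal.span {f})) := by
    rw [Ideal.mem_comap, Ideal.Quotient.eq_zero_iff_mem.mpr (Ideal.mem_span_singleton_self f)]
    exact P.zero_mem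
  obtain ⟨hd0, hd1, hd2, hd3⟩ := pderivs k
  rw [← hf] at hd0 hd1 hd2 hd3
  -- at most one of `2, 3, 5` vanishes in the field `k`
  have h23 : (2 : k) = 0 → (3 : k) ≠ 0 := fun h2 h3 => one_ne_zero (by linear_combination h3 - h2 : (1 : k) = 0)
  have h25 : (2 : k) = 0 → (5 : k) ≠ 0 := fun h2 h5 => one_ne_zero (by linear_combination h5 - 2 * h2 : (1 : k) = 0)
  have h35 : (3 : k) = 0 → (5 : k) ≠ 0 := fun h3 h5 => one_ne_zero (by linear_combination 2 * h3 - h5 : (1 : k) = 0)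
  -- not all three line variables lie in `P₀`
  have hnot : ¬ ((MvPolynomial.X 1 : MvPolynomial (Fin 4) k) ∈ P.comap (Ideal.Quotient.mk (Ideal.span {f})) ∧
      (MvPolynomial.X 2 : MvPolynomial (Fin 4) k) ∈ P.comap (Ideal.Quotient.mk (Ideal.span {f})) ∧
      (MvPolynomial.X 3 : MvPolynomial (Fin 4) k) ∈ P.comap (Ideal.Quotient.mk (Ideal.span {f}))) := by
    rintro ⟨h1, h2, h3⟩
    refine hP ?_
    rw [Ideal.span_le]
    rintro _ ⟨j, hj, rfl⟩
    simp only [Finset.coe_insert, Finset.coe_singleton, Set.mem_insert_iff, Set.mem_singleton_iff] at hj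
    rcases hj with rfl | rfl | rfl
    exacts [h1, h2, h3]
  by_cases hx1 : (MvPolynomial.X 1 : MvPolynomial (Fin 4) k) ∈ P.comap (Ideal.Quotient.mk (Ideal.span {f}))
  · -- `X₁ ∈ P₀`: then `X₃² + X₂⁵ ∈ P₀` and `X₂ ∉ P₀`
    have h35' : (MvPolynomial.X 3 ^ 2 + MvPolynomial.X 2 ^ 5 : MvPolynomial (Fin 4) k) ∈
        P.comap (Ideal.Quotient.mk (Ideal.span {f})) := by
      have e : (MvPolynomial.X 3 ^ 2 + MvPolynomial.X 2 ^ 5 : MvPolynomial (Fin 4) k) =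
          f - MvPolynomial.X 1 * (MvPolynomial.X 1 ^ 2 + MvPolynomial.X 0 * MvPolynomial.X 1 * MvPolynomial.X 2 ^ 2) := by
        rw [hf]; ring
      rw [e]
      exact Ideal.sub_mem _ hfP (Ideal.mul_mem_right _ _ hx1)
    have hx2 : (MvPolynomial.X 2 : MvPolynomial (Fin 4) k) ∉ P.comap (Ideal.Quotient.mk (Ideal.span {f})) := fun hx2 => by
      refine hnot ⟨hx1, hx2, hprime.mem_of_pow_mem 2 ?_⟩
      have e : (MvPolynomial.X 3 ^ 2 : MvPolynomial (Fin 4) k) = (MvPolynomial.X 3 ^ 2 + MvPolynomial.X 2 ^ 5) -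
          MvPolynomial.X 2 * MvPolynomial.X 2 ^ 4 := by ring
      rw [e]
      exact Ideal.sub_mem _ h35' (Ideal.mul_mem_right _ _ hx2)
    by_cases h5 : (5 : k) = 0
    · -- characteristic `5`: use `∂f/∂X₃ = 2X₃`
      have hx3 : (MvPolynomial.X 3 : MvPolynomial (Fin 4) k) ∉ P.comap (Ideal.Quotient.mk (Ideal.span {f})) := fun hx3 => by
        refine hx2 (hprime.mem_of_pow_mem 5 ?_)
        have e : (MvPolynomial.X 2 ^ 5 : MvPolynomial (Fin 4) k) = (MvPolynomial.X 3 ^ 2 + MvPolynomial.X 2 ^ 5) -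
            MvPolynomial.X 3 * MvPolynomial.X 3 := by ring
        rw [e]
        exact Ideal.sub_mem _ h35' (Ideal.mul_mem_right _ _ hx3)
      refine HypersurfaceRegular.stub_hypersurfaceRegularOfPderiv k 4 f 3 P (fun hd => hx3 ?_)
      rw [hd3] at hd
      exact E8OffCentreRegular.mem_of_C_mul_mem _ (fun h2 => h25 h2 h5) hd
    · -- `5 ≠ 0`: use `∂f/∂X₂ = 5X₂⁴ + 2X₀X₁²X₂`
      refine HypersurfaceRegular.stub_hypersurfaceRegularOfPderiv k 4 f 2 P (fun hd => hx2 (hprime.mem_of_pow_mem 4 ?_))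
      rw [hd2] at hd
      refine E8OffCentreRegular.mem_of_C_mul_mem _ h5 ?_
      have e : (MvPolynomial.C 5 * MvPolynomial.X 2 ^ 4 : MvPolynomial (Fin 4) k) = (MvPolynomial.C 5 * MvPolynomial.X 2 ^ 4 +
          MvPolynomial.C 2 * (MvPolynomial.X 0 * MvPolynomial.X 1 ^ 2 * MvPolynomial.X 2)) -
          MvPolynomial.X 1 * (MvPolynomial.C (2 : k) * MvPolynomial.X 0 * MvPolynomial.X 1 * MvPolynomial.X 2) := by ring
      rw [e]
      exact Ideal.sub_mem _ hd (Ideal.mul_mem_right _ _ hx1)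
  · by_cases hx2 : (MvPolynomial.X 2 : MvPolynomial (Fin 4) k) ∈ P.comap (Ideal.Quotient.mk (Ideal.span {f}))
    · -- `X₁ ∉ P₀`, `X₂ ∈ P₀`: `X₃² + X₁³ ∈ P₀`
      have h31 : (MvPolynomial.X 3 ^ 2 + MvPolynomial.X 1 ^ 3 : MvPolynomial (Fin 4) k) ∈
          P.comap (Ideal.Quotient.mk (Ideal.span {f})) := by
        have e : (MvPolynomial.X 3 ^ 2 + MvPolynomial.X 1 ^ 3 : MvPolynomial (Fin 4) k) =
            f - MvPolynomial.X 2 * (MvPolynomial.X 2 ^ 4 + MvPolynomial.X 0 * MvPolynomial.X 1 ^ 2 * MvPolynomial.X 2) := by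
          rw [hf]; ring
        rw [e]
        exact Ideal.sub_mem _ hfP (Ideal.mul_mem_right _ _ hx2)
      by_cases h3 : (3 : k) = 0
      · -- characteristic `3`: use `∂f/∂X₃ = 2X₃`
        have hx3 : (MvPolynomial.X 3 : MvPolynomial (Fin 4) k) ∉ P.comap (Ideal.Quotient.mk (Ideal.span {f})) := fun hx3 => by
          refine hx1 (hprime.mem_of_pow_mem 3 ?_)
          have e : (MvPolynomial.X 1 ^ 3 : MvPolynomial (Fin 4) k) = (MvPolynomial.X 3 ^ 2 + MvPolynomial.X 1 ^ 3) -
              MvPolynomial.X 3 * MvPolynomial.X 3 := by ring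
          rw [e]
          exact Ideal.sub_mem _ h31 (Ideal.mul_mem_right _ _ hx3)
        refine HypersurfaceRegular.stub_hypersurfaceRegularOfPderiv k 4 f 3 P (fun hd => hx3 ?_)
        rw [hd3] at hd
        exact E8OffCentreRegular.mem_of_C_mul_mem _ (fun h2 => h23 h2 h3) hd
      · -- `3 ≠ 0`: use `∂f/∂X₁ = 3X₁² + 2X₀X₁X₂²`
        refine HypersurfaceRegular.stub_hypersurfaceRegularOfPderiv k 4 f 1 P (fun hd => hx1 (hprime.mem_of_pow_mem 2 ?_))
        rw [hd1] at hd
        refine E8OffCentreRegular.mem_of_C_mul_mem _ h3 ?_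
        have e : (MvPolynomial.C 3 * MvPolynomial.X 1 ^ 2 : MvPolynomial (Fin 4) k) = (MvPolynomial.C 3 * MvPolynomial.X 1 ^ 2 +
            MvPolynomial.C 2 * (MvPolynomial.X 0 * MvPolynomial.X 1 * MvPolynomial.X 2 ^ 2)) -
            MvPolynomial.X 2 * (MvPolynomial.C (2 : k) * MvPolynomial.X 0 * MvPolynomial.X 1 * MvPolynomial.X 2) := by ring
        rw [e]
        exact Ideal.sub_mem _ hd (Ideal.mul_mem_right _ _ hx2)
    · -- `X₁, X₂ ∉ P₀`: use `∂f/∂X₀ = X₁²X₂²`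
      refine HypersurfaceRegular.stub_hypersurfaceRegularOfPderiv k 4 f 0 P (fun hd => ?_)
      rw [hd0] at hd
      rcases hprime.mem_or_mem hd with h | h
      · exact hx1 (hprime.mem_of_pow_mem 2 h)
      · exact hx2 (hprime.mem_of_pow_mem 2 h)

end Summit.ResolutionOfSingularities.ResolutionOfSingularities.Theorems.FInjectiveMacaulayfication.E8LineDeformedData

end
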